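import Mathlib
import Literature.Barriers.ValiantsHypothesis.AlgebraicNaturalProofs
import Summits.ValiantsHypothesis.ValiantsHypothesis.Theorems.BarrierLeverPartitionMinorsHitByVPSmallLayouts
import Summits.ValiantsHypothesis.ValiantsHypothesis.Theorems.BarrierLeverPartitionMinorsHitByVPProductStatesGeneral
import Summits.ValiantsHypothesis.ValiantsHypothesis.Theorems.BarrierLeverPartitionMinorsHitByVPSplitDoor
import Summits.ValiantsHypothesis.ValiantsHypothesis.Theses.BarrierLever

/-!
# Route BarrierLever — item `PartitionMinorsHitByVP` (stmt-ValiantsHypothesis-19717):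
# the SPLIT-LEAVES door assembled to the route declaration

Helper file (`--supports stmt-ValiantsHypothesis-19717`; cell valiant-natproofs, rung V4, 𝒟-side,
prover seat valiant-natproofs-prover gen 6). Definition-free. Closes NO item. Supersedes the
hypothesis of `…ThresholdDoorAssembled.partitionMinorsHitByVP_of_thresholdSplits` (whose
product-state-only cells exclude tiny rank-one cells, kit j253844): here a LEAF (the whole layout, or
one of the two threshold cells) is acceptable if it is SMALL (`≤ (h+h)^c` rows; hit by the cell's
`…partitionMinor_hit_of_card_le`, seat val-np-p3) or certified by ONE product state (arbitrary
complex site tables, `…ProductStatesC`).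

* `smallCircuits_mono` — `SmallCircuits ℂ n b ⊆ SmallCircuits ℂ n b'` for `b ≤ b'`, `1 ≤ n`.
* `leaf_hit` — a leaf indexed by a subtype of `Fin r` (rows `i`, columns `e i`) that is small or
  product-certified carries some `f ∈ SmallCircuits ℂ (h+h) (c+3)` with nonsingular cell matrix.
* **`partitionMinorsHitByVP_of_splitLeaves`** — the SPLIT-LEAVES CONJECTURE (eventually in `h`:
  every injective layout is a good leaf or has a bi-threshold split into two good leaves) implies
  item `PartitionMinorsHitByVP` VERBATIM with `b = c + 4`. Census for the hypothesis: kit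
  j253355/j253364/j253366/j253367/j253772/j253844 (h = 3 exhaustive, h ≤ 8 sampled; memo
  `HOME/prover/gen6/ADAPTIVE-WITNESSES-MEMO-g6.md` §7–§10).

WHAT THIS IS NOT: the hypothesis is OPEN; nothing on crux 14610 / VP vs VNP.
-/

set_option linter.dupNamespace false

namespace Summit.ValiantsHypothesis.ValiantsHypothesis.Theorems.BarrierLever.SplitDoor

open Finset
open Literature.Barriers.ValiantsHypothesis
open Summit.ValiantsHypothesis.ValiantsHypothesis.Theorems.BarrierLever.ProductStatesC
  (coeff_prodStateC twoProdStatesC_mem_smallCircuits)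
open Summit.ValiantsHypothesis.ValiantsHypothesis.Theorems.BarrierLever.ProductStateSums
  (partitionMinor_hit_of_card_le)

/-- Monotonicity of `SmallCircuits` in the size exponent. -/
theorem smallCircuits_mono {n b b' : ℕ} (hn : 1 ≤ n) (hb : b ≤ b') :
    SmallCircuits ℂ n b ⊆ SmallCircuits ℂ n b' := fun _ hf =>
  ⟨hf.1, hf.2.trans (Nat.pow_le_pow_right hn hb)⟩

variable {h r : ℕ}

/-- **A good leaf is hit.** For a cell given by rows `{i // p i}` and columns `e i` (`e` a bijection
onto `{j // q j}`): if the cell is small (`card ≤ (h+h)^c`) or ONE product state has a nonsingular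
cell matrix, some `f ∈ SmallCircuits ℂ (h+h) (c+3)` has a nonsingular cell matrix (`h ≥ 4`). -/
theorem leaf_hit (c : ℕ) (hh : 4 ≤ h) (u w : Fin r → Finset (Fin h)) (hu : Function.Injective u)
    (hw : Function.Injective w) {p q : Fin r → Prop} [DecidablePred p] [DecidablePred q]
    (e : {i // p i} ≃ {j // q j})
    (hleaf : Fintype.card {i // p i} ≤ (h + h) ^ c ∨
      ∃ P : Fin h → Bool → Bool → ℂ, (Matrix.of fun i i' : {i // p i} =>
        ∏ a : Fin h, P a (decide (a ∈ u i.1)) (decide (a ∈ w (e i').1))).det ≠ 0) :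
    ∃ f ∈ SmallCircuits ℂ (h + h) (c + 3), (Matrix.of fun i i' : {i // p i} => MvPolynomial.coeff
        (∑ a ∈ u i.1, Finsupp.single (Fin.castAdd h a) 1 +
          ∑ c ∈ w (e i').1, Finsupp.single (Fin.natAdd h c) 1) f).det ≠ 0 := by
  classical
  have h1 : 1 ≤ h + h := by omega
  rcases hleaf with hsmall | ⟨P, hP⟩
  · -- small leaf: reindex by `Fin m` and use the polynomial-size range
    set m := Fintype.card {i // p i} with hm
    let eq : {i // p i} ≃ Fin m := Fintype.equivFin _
    have hu' : Function.Injective (fun k : Fin m => u (eq.symm k).1) := fun k k' hk =>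
      eq.symm.injective (Subtype.ext (hu hk))
    have hw' : Function.Injective (fun k : Fin m => w (e (eq.symm k)).1) := fun k k' hk =>
      eq.symm.injective (e.injective (Subtype.ext (hw hk)))
    obtain ⟨f, hf, hdet⟩ := partitionMinor_hit_of_card_le c h hh m hsmall _ _ hu' hw'
    refine ⟨f, smallCircuits_mono h1 (by omega) hf, ?_⟩
    have hre : (Matrix.of fun i i' : {i // p i} => MvPolynomial.coeff
        (∑ a ∈ u i.1, Finsupp.single (Fin.castAdd h a) 1 +
          ∑ c ∈ w (e i').1, Finsupp.single (Fin.natAdd h c) 1) f) =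
        (Matrix.of fun k k' : Fin m => MvPolynomial.coeff
          (∑ a ∈ u (eq.symm k).1, Finsupp.single (Fin.castAdd h a) 1 +
            ∑ c ∈ w (e (eq.symm k')).1, Finsupp.single (Fin.natAdd h c) 1) f).reindex
          eq.symm eq.symm := by
      ext i i'
      simp only [Matrix.reindex_apply, Matrix.submatrix_apply, Matrix.of_apply, Equiv.symm_symm,
        Equiv.symm_apply_apply]
    rw [hre, Matrix.det_reindex_self]
    exact hdet
  · -- product-state leaf
    refine ⟨_, smallCircuits_mono h1 (by omega) (twoProdStatesC_mem_smallCircuits hh 1 0 P P), ?_⟩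
    have hM : (Matrix.of fun i i' : {i // p i} => MvPolynomial.coeff
        (∑ a ∈ u i.1, Finsupp.single (Fin.castAdd h a) 1 +
          ∑ c ∈ w (e i').1, Finsupp.single (Fin.natAdd h c) 1)
        (MvPolynomial.C (1 : ℂ) * (∏ a, ∑ p : Bool × Bool, MvPolynomial.C (P a p.1 p.2) *
            MvPolynomial.X (Fin.castAdd h a) ^ p.1.toNat *
            MvPolynomial.X (Fin.natAdd h ((Equiv.refl (Fin h)) a)) ^ p.2.toNat) +
          MvPolynomial.C (0 : ℂ) * (∏ a, ∑ p : Bool × Bool, MvPolynomial.C (P a p.1 p.2) *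
            MvPolynomial.X (Fin.castAdd h a) ^ p.1.toNat *
            MvPolynomial.X (Fin.natAdd h ((Equiv.refl (Fin h)) a)) ^ p.2.toNat) :
            MvPolynomial (Fin (h + h)) ℂ)) =
        Matrix.of fun i i' : {i // p i} =>
          ∏ a : Fin h, P a (decide (a ∈ u i.1)) (decide (a ∈ w (e i').1)) := by
      ext i i'
      rw [Matrix.of_apply, Matrix.of_apply, MvPolynomial.coeff_add, MvPolynomial.coeff_C_mul,
        MvPolynomial.coeff_C_mul, coeff_prodStateC, one_mul, zero_mul, add_zero]
      rfl
    rw [hM]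
    exact hP

/-- **The split-leaves conjecture implies item 19717** (`b = c + 4`). -/
theorem partitionMinorsHitByVP_of_splitLeaves (c h₀ : ℕ)
    (hsplit : ∀ h : ℕ, h₀ ≤ h → ∀ (r : ℕ) (u w : Fin r → Finset (Fin h)),
      Function.Injective u → Function.Injective w →
      r ≤ (h + h) ^ c ∨
      (∃ P : Fin h → Bool → Bool → ℂ, (Matrix.of fun i j : Fin r =>
          ∏ a : Fin h, P a (decide (a ∈ u i)) (decide (a ∈ w j))).det ≠ 0) ∨
      (∃ (lam mu : Fin h → ℤ) (cu cw : ℤ)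
        (e : {i : Fin r // cu < ∑ a ∈ u i, lam a} ≃ {j : Fin r // cw < ∑ c ∈ w j, mu c})
        (e' : {i : Fin r // ¬ cu < ∑ a ∈ u i, lam a} ≃ {j : Fin r // ¬ cw < ∑ c ∈ w j, mu c}),
        (Fintype.card {i : Fin r // cu < ∑ a ∈ u i, lam a} ≤ (h + h) ^ c ∨
          ∃ P : Fin h → Bool → Bool → ℂ, (Matrix.of fun i i' : {i : Fin r // cu < ∑ a ∈ u i, lam a} =>
            ∏ a : Fin h, P a (decide (a ∈ u i.1)) (decide (a ∈ w (e i').1))).det ≠ 0) ∧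
        (Fintype.card {i : Fin r // ¬ cu < ∑ a ∈ u i, lam a} ≤ (h + h) ^ c ∨
          ∃ Q : Fin h → Bool → Bool → ℂ,
            (Matrix.of fun i i' : {i : Fin r // ¬ cu < ∑ a ∈ u i, lam a} =>
              ∏ a : Fin h, Q a (decide (a ∈ u i.1)) (decide (a ∈ w (e' i').1))).det ≠ 0))) :
    Summit.ValiantsHypothesis.ValiantsHypothesis.Theses.BarrierLever.PartitionMinorsHitByVP := by
  classical
  refine ⟨c + 4, max h₀ 4, fun h hh r u w hu hw => ?_⟩
  have hh4 : 4 ≤ h := (le_max_right _ _).trans hh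
  have h1 : 1 ≤ h + h := by omega
  rcases hsplit h ((le_max_left _ _).trans hh) r u w hu hw with hsmall | ⟨P, hP⟩ |
      ⟨lam, mu, cu, cw, e, e', hleft, hright⟩
  · obtain ⟨f, hf, hdet⟩ := partitionMinor_hit_of_card_le c h hh4 r hsmall u w hu hw
    exact ⟨f, smallCircuits_mono h1 (by omega) hf, hdet⟩
  · -- one product state on the whole layout: a leaf indexed by all of `Fin r`
    obtain ⟨f, hf, hdet⟩ := leaf_hit (p := fun _ : Fin r => True) (q := fun _ : Fin r => True)
      c hh4 u w hu hw (Equiv.refl _) (Or.inr ⟨P, by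
        have hre : (Matrix.of fun i i' : {i : Fin r // True} =>
            ∏ a : Fin h, P a (decide (a ∈ u i.1)) (decide (a ∈ w ((Equiv.refl _) i').1))) =
            (Matrix.of fun i j : Fin r => ∏ a : Fin h, P a (decide (a ∈ u i)) (decide (a ∈ w j))).reindex
              (Equiv.subtypeUnivEquiv (fun _ => trivial)).symm
              (Equiv.subtypeUnivEquiv (fun _ => trivial)).symm := by
          ext i i'; rfl
        rw [hre, Matrix.det_reindex_self]; exact hP⟩)
    refine ⟨f, smallCircuits_mono h1 (by omega) hf, ?_⟩
    have hre : (Matrix.of fun i j : Fin r => MvPolynomial.coeff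
        (∑ a ∈ u i, Finsupp.single (Fin.castAdd h a) 1 +
          ∑ c ∈ w j, Finsupp.single (Fin.natAdd h c) 1) f) =
        (Matrix.of fun i i' : {i : Fin r // True} => MvPolynomial.coeff
          (∑ a ∈ u i.1, Finsupp.single (Fin.castAdd h a) 1 +
            ∑ c ∈ w ((Equiv.refl _) i').1, Finsupp.single (Fin.natAdd h c) 1) f).reindex
          (Equiv.subtypeUnivEquiv (fun _ => trivial)) (Equiv.subtypeUnivEquiv (fun _ => trivial)) := by
      ext i j; rfl
    rw [hre, Matrix.det_reindex_self]
    exact hdet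
  · obtain ⟨f₁, hf₁, hd₁⟩ := leaf_hit c hh4 u w hu hw e hleft
    obtain ⟨f₂, hf₂, hd₂⟩ := leaf_hit c hh4 u w hu hw e' hright
    exact partitionMinor_hit_of_split h r (c + 3) (by omega) (by omega) u w lam mu cu cw e e' f₁ f₂
      hf₁ hf₂ hd₁ hd₂

end Summit.ValiantsHypothesis.ValiantsHypothesis.Theorems.BarrierLever.SplitDoor
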